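import Summits.QuantumFields.BalabanUV.Beta.FP.TorusCompositeCovarianceTwoPolarSym
import Summits.QuantumFields.BalabanUV.Beta.FP.TorusCompositeCovarianceTwoRowsSym

/-!
# `BalabanUV.Beta.FP.TorusCompositeRowsDirectionalSym` — road «FP» for binder row D1, ROUTE T, (β1) «sym» column: **THE `Q`-SIDE OF THE SYM TOWER's DOOR READ AS
# FUNCTIONS OF THE DIRECTION — (BI)LINEARITY OF OUR SYM COMPOSITE JETS ALONG A LINEAR READ-OUT `h := hv v`, AND #21-Sym's `c2` ROW AT THE POLARISED FINE JET
# `c² • compIns₂₂Sym h h`** (the (β1) twin of `TorusCompositeRowsDirectional`, proofs line for line)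
# (the eight `Q`-side obligations of the OWNER's #41c-Sym `NestedDoorSocketTowerSym` at the record of this lineage's ♭ sym tower — supplied BY NAME)

WHY.  #41c-Sym displays, as #41c does, for a direction module `V` with read-out `hv`, the jets `Q₁₁f Q₂₁f` (linear), `Q₁₂f Q₂₂f` (linear in each of two slots) and the rows `c1 c2 d1 d2`
for every direction.  At the record of OUR ♭ sym tower: `Q₁₁f v := c • compIns₁Sym (hv v)`, `Q₁₂f v v′ := c² • compIns₂₂Sym (hv v) (hv v′)`, `Q₂₁f v :=` the top step's sym member along
`(cθ_{n+1})•(compRowsSym·hv v)`, `Q₂₂f v v′ := c_{lev 0} •` the top step's sym bi-member along the two transported directions.  This file proves their (bi)linearity in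
#41c-Sym's literal hypothesis shapes from `hv`'s (`TorusCompositeCovarianceTwoPolarSym`'s `compIns₁Sym_add ∕ _smul`, `compIns₂₂Sym_add_left ∕ … ∕ _smul_right hc`), and
#21-Sym's `c2` row with the fine second jet on the DIAGONAL of the bilinear companion (`compIns₂₂Sym_self` + `TorusCompositeCovarianceTwoRowsSym.torus_c2_towerSym`, at the
record's `d + 1 = 4`); `c1 d1` are `torus_c1_towerSym ∕ torus_d1_towerSym` and `d2` is `torus_d2_towerSym` VERBATIM at `h := hv v` (no wrapper needed).

WHAT.  §1 `Q11f_lin`, `Q21f_lin`, `Q12f_lin_left ∕ _right`, `Q22f_lin_left ∕ _right` (every `d`); §2 `torus_c2_towerSym_polar` (`d + 1 = 4`).  [folklore] finite sums BY NAME; no `def`, no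
`def … : Prop`, nothing cited, 0 sorry.  Nothing of the dictionary ∕ Bałaban's asserted (OUR ♭ objects = the admissible working presentation, R-D1-g46-1).

HONEST DEPENDENCY (page 1, mandatory): continuum YM on T⁴ ⇐ BetaPertH ∧ nine spine estimates (0/9 proved); BetaPertH ⇐ (D1) ∧ (D4) ∧ CAP+tail;
G-an2-4 gates asym, D1 and NE2/3/4.  HONEST FRAMING (cell contract, verbatim): «discharging `BetaPertH` makes Bałaban's UV stability UNCONDITIONAL —
a real constructive-QFT result; it is NOT the continuum limit and NOT the Clay problem.»  ABSOLUTE RULE (cell charter, verbatim): «No internally-minted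
statement may enter as a cited fact. Every hypothesis is either kernel-proved in this package or a verbatim quotation of a PUBLISHED theorem with page
reference. The manuscript(s) under audit are NOT citable for their own disputed steps — they are the thing under adjudication; programme-internal
(2001/route/tribunal) claims are never citable.»  0 estimates; 0∕4 row-D1 binders (hW, hR, D1Tel, D1Rep); NOT (T-ID), NOT (J-a) complete, NOT SDF, NOT D1,
NOT BetaPertH, NOT continuum, NOT Clay.  D1 formalisation swarm LEAF PROVER 02 (b2b-balaban-beta-d1-formalise-leaf-02 gen 32), 2026-08-24.  No existing file touched.
-/

noncomputable section

open scoped BigOperators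

namespace Summit.QuantumFields.BalabanUV.Beta.FP.TorusCompositeRowsDirectionalSym

open Matrix Finset
open Literature.MathematicalPhysics.QuantumFieldTheory
open Literature.MathematicalPhysics.QuantumFieldTheory.Balaban1983to89
open Literature.MathematicalPhysics.QuantumFieldTheory.Balaban1983to89.Beta
open ExpKernelCalculus (MKer)
open B4TorusKernel.MultiPeriod (translate)
open B5Prop11Plancherel (fine)
open B6Lemma24Torus (pbox)
open AffineAveraging (Site box toSite unitVec)
open AveragingContoursRooted (ctr ctrOff)
open Summit.QuantumFields.BalabanUV.Beta.SymAveragingHessianCounts (symVhSAt)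
open Summit.QuantumFields.BalabanUV.Beta.SymAveragingMixedJetTables (symVh₂SAt)
open OneStepResolventKernel (Fib)
open Summit.QuantumFields.BalabanUV.Beta.BorderedHessian (stepScale)
open Summit.QuantumFields.BalabanUV.Beta.FP.KernelPeriodisationFib (Idx perF)
open Summit.QuantumFields.BalabanUV.Beta.FP.KernelPeriodisationFibLoc (dper)
open Summit.QuantumFields.BalabanUV.Beta.FP.TorusGaugeCovariance (tdelta)
open Summit.QuantumFields.BalabanUV.Beta.FP.TorusCombRows (Res)
open Summit.QuantumFields.BalabanUV.Beta.FP.TorusCompositeObjects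
open Summit.QuantumFields.BalabanUV.Beta.FP.TorusCompositeFP (evalN)
open Summit.QuantumFields.BalabanUV.Beta.FP.TorusCompositeObjectsG (compRowsSym)
open Summit.QuantumFields.BalabanUV.Beta.FP.TorusCompositeCovarianceOneSym (compIns₁Sym)
open Summit.QuantumFields.BalabanUV.Beta.FP.TorusCompositeCovarianceTwoPolarSym (compIns₂₂Sym compIns₂Sym compIns₂₂Sym_self compIns₁Sym_add compIns₁Sym_smul
  compIns₂₂Sym_add_left compIns₂₂Sym_smul_left compIns₂₂Sym_add_right compIns₂₂Sym_smul_right)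
open Summit.QuantumFields.BalabanUV.Beta.FP.TorusCompositeCovarianceTwoRowsSym (torus_c2_towerSym)

variable {d : ℕ}

section Directional

variable (Lc : ℕ) [NeZero Lc] (M' : Fin (d + 1) → ℕ) [∀ μ, NeZero (M' μ)] (lev : ℕ → ℕ) (rs : ℕ → (Fin (d + 1) → ℕ)) (n : ℕ) (c : ℝ)
  {V : Type*} [AddCommGroup V] [Module ℝ V] (hv : V → (↥(pbox (towerTorus Lc M' (n + 1))) × Fin (d + 1) → ℝ))

/-! ## §1 (Bi)linearity of the `Q`-side jets along a linear read-out, in #41c's hypothesis shapes -/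

/-- [folklore] **`Q₁₁f v := c • compIns₁Sym … (hv v)` IS LINEAR** (#41c-Sym's `hQ₁₁l` shape; `compIns₁Sym_add ∕ _smul`). -/
theorem Q11f_lin (hhv : ∀ (r : ℝ) (x y : V), hv (r • x + y) = r • hv x + hv y) :
    ∀ (r : ℝ) (x y : V), c • compIns₁Sym Lc M' lev rs (n + 1) (hv (r • x + y)) = r • (c • compIns₁Sym Lc M' lev rs (n + 1) (hv x)) + c • compIns₁Sym Lc M' lev rs (n + 1) (hv y) := by
  intro r x y
  rw [hhv, compIns₁Sym_add, compIns₁Sym_smul, smul_add, smul_comm c r]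

/-- [folklore] **`Q₁₂f v v′ := c² • compIns₂₂Sym … (hv v) (hv v′)` IS LINEAR IN THE FIRST SLOT** (#41c-Sym's `hQ₁₂l`; `compIns₂₂Sym_add_left ∕ _smul_left`). -/
theorem Q12f_lin_left (hhv : ∀ (r : ℝ) (x y : V), hv (r • x + y) = r • hv x + hv y) :
    ∀ (r : ℝ) (x y z : V), c ^ 2 • compIns₂₂Sym Lc M' lev rs (n + 1) (hv (r • x + y)) (hv z) = r • (c ^ 2 • compIns₂₂Sym Lc M' lev rs (n + 1) (hv x) (hv z)) + c ^ 2 • compIns₂₂Sym Lc M' lev rs (n + 1) (hv y) (hv z) := by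
  intro r x y z
  rw [hhv, compIns₂₂Sym_add_left, compIns₂₂Sym_smul_left, smul_add, smul_comm (c ^ 2) r]

/-- [folklore] **… AND IN THE SECOND SLOT** (#41c-Sym's `hQ₁₂r`; `compIns₂₂Sym_add_right ∕ _smul_right hc`). -/
theorem Q12f_lin_right (hc : ctrOff (d + 1) Lc ∈ box (d + 1) Lc) (hhv : ∀ (r : ℝ) (x y : V), hv (r • x + y) = r • hv x + hv y) :
    ∀ (r : ℝ) (x y z : V), c ^ 2 • compIns₂₂Sym Lc M' lev rs (n + 1) (hv z) (hv (r • x + y)) = r • (c ^ 2 • compIns₂₂Sym Lc M' lev rs (n + 1) (hv z) (hv x)) + c ^ 2 • compIns₂₂Sym Lc M' lev rs (n + 1) (hv z) (hv y) := by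
  intro r x y z
  rw [hhv, compIns₂₂Sym_add_right Lc hc (n + 1) M' lev rs, compIns₂₂Sym_smul_right Lc hc (n + 1) M' lev rs, smul_add, smul_comm (c ^ 2) r]

/-- [folklore] **`Q₂₁f v :=` THE TOP STEP's SYM MEMBER ALONG `(cθ_{n+1})•(compRowsSym·hv v)` IS LINEAR** (#41c-Sym's `hQ₂₁l`). -/
theorem Q21f_lin {κ : Type*} (pμ' : κ → ↥(pbox M')) (mμ' : κ → Fin (d + 1)) (hhv : ∀ (r : ℝ) (x y : V), hv (r • x + y) = r • hv x + hv y) :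
    ∀ (r : ℝ) (x y : V),
      (∑ a' : ↥(pbox M') × Fin (d + 1), ((c * (((Lc : ℝ) ^ (d + 1) * stepScale d Lc (lev 0)) * (∏ i ∈ range (n + 1), (stepScale d Lc (lev (i + 1)) * ((box (d + 1) Lc).card : ℝ)))⁻¹)) * (compRowsSym Lc M' lev rs (n + 1) *ᵥ (hv (r • x + y))) a') •
        (perF M' (dper M' (symVhSAt (ctr (d + 1) Lc) d Lc rfl a'.2 (a'.1 : Site (d + 1))))).submatrix (fun k : κ => ((pμ' k, Sum.inr (mμ' k)) : Idx M' (Fib d)))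
          (fun b : ↥(pbox M') × Fin (d + 1) => ((b.1, Sum.inl b.2) : Idx M' (Fib d))))
        = r • (∑ a' : ↥(pbox M') × Fin (d + 1), ((c * (((Lc : ℝ) ^ (d + 1) * stepScale d Lc (lev 0)) * (∏ i ∈ range (n + 1), (stepScale d Lc (lev (i + 1)) * ((box (d + 1) Lc).card : ℝ)))⁻¹)) * (compRowsSym Lc M' lev rs (n + 1) *ᵥ (hv x)) a') •
        (perF M' (dper M' (symVhSAt (ctr (d + 1) Lc) d Lc rfl a'.2 (a'.1 : Site (d + 1))))).submatrix (fun k : κ => ((pμ' k, Sum.inr (mμ' k)) : Idx M' (Fib d)))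
          (fun b : ↥(pbox M') × Fin (d + 1) => ((b.1, Sum.inl b.2) : Idx M' (Fib d))))
          + (∑ a' : ↥(pbox M') × Fin (d + 1), ((c * (((Lc : ℝ) ^ (d + 1) * stepScale d Lc (lev 0)) * (∏ i ∈ range (n + 1), (stepScale d Lc (lev (i + 1)) * ((box (d + 1) Lc).card : ℝ)))⁻¹)) * (compRowsSym Lc M' lev rs (n + 1) *ᵥ (hv y)) a') •
        (perF M' (dper M' (symVhSAt (ctr (d + 1) Lc) d Lc rfl a'.2 (a'.1 : Site (d + 1))))).submatrix (fun k : κ => ((pμ' k, Sum.inr (mμ' k)) : Idx M' (Fib d)))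
          (fun b : ↥(pbox M') × Fin (d + 1) => ((b.1, Sum.inl b.2) : Idx M' (Fib d)))) := by
  intro r x y
  rw [hhv, Matrix.mulVec_add, Matrix.mulVec_smul, Finset.smul_sum, ← Finset.sum_add_distrib]
  refine Finset.sum_congr rfl fun a' _ => ?_
  rw [Pi.add_apply, Pi.smul_apply, smul_eq_mul, mul_add, add_smul, smul_smul]
  congr 2
  ring

/-- [folklore] **`Q₂₂f v v′ := c_{lev 0} •` THE TOP STEP's BI-MEMBER ALONG THE TWO TRANSPORTED DIRECTIONS IS LINEAR IN THE FIRST SLOT** (#41c-Sym's `hQ₂₂l`). -/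
theorem Q22f_lin_left {κ : Type*} (pμ' : κ → ↥(pbox M')) (mμ' : κ → Fin (d + 1)) (hhv : ∀ (r : ℝ) (x y : V), hv (r • x + y) = r • hv x + hv y) :
    ∀ (r : ℝ) (x y z : V),
      (((Lc : ℝ) ^ (d + 1) * stepScale d Lc (lev 0))⁻¹ •
        ∑ b : ↥(pbox M') × Fin (d + 1), ∑ b' : ↥(pbox M') × Fin (d + 1), (((c * (((Lc : ℝ) ^ (d + 1) * stepScale d Lc (lev 0)) * (∏ i ∈ range (n + 1), (stepScale d Lc (lev (i + 1)) * ((box (d + 1) Lc).card : ℝ)))⁻¹)) * (compRowsSym Lc M' lev rs (n + 1) *ᵥ (hv (r • x + y))) b) * ((c * (((Lc : ℝ) ^ (d + 1) * stepScale d Lc (lev 0)) * (∏ i ∈ range (n + 1), (stepScale d Lc (lev (i + 1)) * ((box (d + 1) Lc).card : ℝ)))⁻¹)) * (compRowsSym Lc M' lev rs (n + 1) *ᵥ (hv z)) b')) •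
          (perF M' (dper M' (fun x z a e => ∑' m : Site (d + 1), (1 / 2 : ℝ) *
            (symVh₂SAt (ctr (d + 1) Lc) Lc b.2 (b.1 : Site (d + 1)) b'.2 (translate M' (b'.1 : Site (d + 1)) m) x z a e
              + symVh₂SAt (ctr (d + 1) Lc) Lc b'.2 (translate M' (b'.1 : Site (d + 1)) m) b.2 (b.1 : Site (d + 1)) x z a e)))).submatrix
            (fun k : κ => ((pμ' k, Sum.inr (mμ' k)) : Idx M' (Fib d))) (fun e : ↥(pbox M') × Fin (d + 1) => ((e.1, Sum.inl e.2) : Idx M' (Fib d))))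
        = r • (((Lc : ℝ) ^ (d + 1) * stepScale d Lc (lev 0))⁻¹ •
        ∑ b : ↥(pbox M') × Fin (d + 1), ∑ b' : ↥(pbox M') × Fin (d + 1), (((c * (((Lc : ℝ) ^ (d + 1) * stepScale d Lc (lev 0)) * (∏ i ∈ range (n + 1), (stepScale d Lc (lev (i + 1)) * ((box (d + 1) Lc).card : ℝ)))⁻¹)) * (compRowsSym Lc M' lev rs (n + 1) *ᵥ (hv x)) b) * ((c * (((Lc : ℝ) ^ (d + 1) * stepScale d Lc (lev 0)) * (∏ i ∈ range (n + 1), (stepScale d Lc (lev (i + 1)) * ((box (d + 1) Lc).card : ℝ)))⁻¹)) * (compRowsSym Lc M' lev rs (n + 1) *ᵥ (hv z)) b')) •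
          (perF M' (dper M' (fun x z a e => ∑' m : Site (d + 1), (1 / 2 : ℝ) *
            (symVh₂SAt (ctr (d + 1) Lc) Lc b.2 (b.1 : Site (d + 1)) b'.2 (translate M' (b'.1 : Site (d + 1)) m) x z a e
              + symVh₂SAt (ctr (d + 1) Lc) Lc b'.2 (translate M' (b'.1 : Site (d + 1)) m) b.2 (b.1 : Site (d + 1)) x z a e)))).submatrix
            (fun k : κ => ((pμ' k, Sum.inr (mμ' k)) : Idx M' (Fib d))) (fun e : ↥(pbox M') × Fin (d + 1) => ((e.1, Sum.inl e.2) : Idx M' (Fib d))))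
          + (((Lc : ℝ) ^ (d + 1) * stepScale d Lc (lev 0))⁻¹ •
        ∑ b : ↥(pbox M') × Fin (d + 1), ∑ b' : ↥(pbox M') × Fin (d + 1), (((c * (((Lc : ℝ) ^ (d + 1) * stepScale d Lc (lev 0)) * (∏ i ∈ range (n + 1), (stepScale d Lc (lev (i + 1)) * ((box (d + 1) Lc).card : ℝ)))⁻¹)) * (compRowsSym Lc M' lev rs (n + 1) *ᵥ (hv y)) b) * ((c * (((Lc : ℝ) ^ (d + 1) * stepScale d Lc (lev 0)) * (∏ i ∈ range (n + 1), (stepScale d Lc (lev (i + 1)) * ((box (d + 1) Lc).card : ℝ)))⁻¹)) * (compRowsSym Lc M' lev rs (n + 1) *ᵥ (hv z)) b')) •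
          (perF M' (dper M' (fun x z a e => ∑' m : Site (d + 1), (1 / 2 : ℝ) *
            (symVh₂SAt (ctr (d + 1) Lc) Lc b.2 (b.1 : Site (d + 1)) b'.2 (translate M' (b'.1 : Site (d + 1)) m) x z a e
              + symVh₂SAt (ctr (d + 1) Lc) Lc b'.2 (translate M' (b'.1 : Site (d + 1)) m) b.2 (b.1 : Site (d + 1)) x z a e)))).submatrix
            (fun k : κ => ((pμ' k, Sum.inr (mμ' k)) : Idx M' (Fib d))) (fun e : ↥(pbox M') × Fin (d + 1) => ((e.1, Sum.inl e.2) : Idx M' (Fib d)))) := by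
  intro r x y z
  rw [hhv, Matrix.mulVec_add, Matrix.mulVec_smul, smul_comm r, ← smul_add]
  congr 1
  rw [Finset.smul_sum, ← Finset.sum_add_distrib]
  refine Finset.sum_congr rfl fun b _ => ?_
  rw [Finset.smul_sum, ← Finset.sum_add_distrib]
  refine Finset.sum_congr rfl fun b' _ => ?_
  rw [Pi.add_apply, Pi.smul_apply, smul_eq_mul, smul_smul, ← add_smul]
  congr 1
  ring

/-- [folklore] **… AND IN THE SECOND SLOT** (#41c-Sym's `hQ₂₂r`). -/
theorem Q22f_lin_right {κ : Type*} (pμ' : κ → ↥(pbox M')) (mμ' : κ → Fin (d + 1)) (hhv : ∀ (r : ℝ) (x y : V), hv (r • x + y) = r • hv x + hv y) :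
    ∀ (r : ℝ) (x y z : V),
      (((Lc : ℝ) ^ (d + 1) * stepScale d Lc (lev 0))⁻¹ •
        ∑ b : ↥(pbox M') × Fin (d + 1), ∑ b' : ↥(pbox M') × Fin (d + 1), (((c * (((Lc : ℝ) ^ (d + 1) * stepScale d Lc (lev 0)) * (∏ i ∈ range (n + 1), (stepScale d Lc (lev (i + 1)) * ((box (d + 1) Lc).card : ℝ)))⁻¹)) * (compRowsSym Lc M' lev rs (n + 1) *ᵥ (hv z)) b) * ((c * (((Lc : ℝ) ^ (d + 1) * stepScale d Lc (lev 0)) * (∏ i ∈ range (n + 1), (stepScale d Lc (lev (i + 1)) * ((box (d + 1) Lc).card : ℝ)))⁻¹)) * (compRowsSym Lc M' lev rs (n + 1) *ᵥ (hv (r • x + y))) b')) •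
          (perF M' (dper M' (fun x z a e => ∑' m : Site (d + 1), (1 / 2 : ℝ) *
            (symVh₂SAt (ctr (d + 1) Lc) Lc b.2 (b.1 : Site (d + 1)) b'.2 (translate M' (b'.1 : Site (d + 1)) m) x z a e
              + symVh₂SAt (ctr (d + 1) Lc) Lc b'.2 (translate M' (b'.1 : Site (d + 1)) m) b.2 (b.1 : Site (d + 1)) x z a e)))).submatrix
            (fun k : κ => ((pμ' k, Sum.inr (mμ' k)) : Idx M' (Fib d))) (fun e : ↥(pbox M') × Fin (d + 1) => ((e.1, Sum.inl e.2) : Idx M' (Fib d))))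
        = r • (((Lc : ℝ) ^ (d + 1) * stepScale d Lc (lev 0))⁻¹ •
        ∑ b : ↥(pbox M') × Fin (d + 1), ∑ b' : ↥(pbox M') × Fin (d + 1), (((c * (((Lc : ℝ) ^ (d + 1) * stepScale d Lc (lev 0)) * (∏ i ∈ range (n + 1), (stepScale d Lc (lev (i + 1)) * ((box (d + 1) Lc).card : ℝ)))⁻¹)) * (compRowsSym Lc M' lev rs (n + 1) *ᵥ (hv z)) b) * ((c * (((Lc : ℝ) ^ (d + 1) * stepScale d Lc (lev 0)) * (∏ i ∈ range (n + 1), (stepScale d Lc (lev (i + 1)) * ((box (d + 1) Lc).card : ℝ)))⁻¹)) * (compRowsSym Lc M' lev rs (n + 1) *ᵥ (hv x)) b')) •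
          (perF M' (dper M' (fun x z a e => ∑' m : Site (d + 1), (1 / 2 : ℝ) *
            (symVh₂SAt (ctr (d + 1) Lc) Lc b.2 (b.1 : Site (d + 1)) b'.2 (translate M' (b'.1 : Site (d + 1)) m) x z a e
              + symVh₂SAt (ctr (d + 1) Lc) Lc b'.2 (translate M' (b'.1 : Site (d + 1)) m) b.2 (b.1 : Site (d + 1)) x z a e)))).submatrix
            (fun k : κ => ((pμ' k, Sum.inr (mμ' k)) : Idx M' (Fib d))) (fun e : ↥(pbox M') × Fin (d + 1) => ((e.1, Sum.inl e.2) : Idx M' (Fib d))))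
          + (((Lc : ℝ) ^ (d + 1) * stepScale d Lc (lev 0))⁻¹ •
        ∑ b : ↥(pbox M') × Fin (d + 1), ∑ b' : ↥(pbox M') × Fin (d + 1), (((c * (((Lc : ℝ) ^ (d + 1) * stepScale d Lc (lev 0)) * (∏ i ∈ range (n + 1), (stepScale d Lc (lev (i + 1)) * ((box (d + 1) Lc).card : ℝ)))⁻¹)) * (compRowsSym Lc M' lev rs (n + 1) *ᵥ (hv z)) b) * ((c * (((Lc : ℝ) ^ (d + 1) * stepScale d Lc (lev 0)) * (∏ i ∈ range (n + 1), (stepScale d Lc (lev (i + 1)) * ((box (d + 1) Lc).card : ℝ)))⁻¹)) * (compRowsSym Lc M' lev rs (n + 1) *ᵥ (hv y)) b')) •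
          (perF M' (dper M' (fun x z a e => ∑' m : Site (d + 1), (1 / 2 : ℝ) *
            (symVh₂SAt (ctr (d + 1) Lc) Lc b.2 (b.1 : Site (d + 1)) b'.2 (translate M' (b'.1 : Site (d + 1)) m) x z a e
              + symVh₂SAt (ctr (d + 1) Lc) Lc b'.2 (translate M' (b'.1 : Site (d + 1)) m) b.2 (b.1 : Site (d + 1)) x z a e)))).submatrix
            (fun k : κ => ((pμ' k, Sum.inr (mμ' k)) : Idx M' (Fib d))) (fun e : ↥(pbox M') × Fin (d + 1) => ((e.1, Sum.inl e.2) : Idx M' (Fib d)))) := by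
  intro r x y z
  rw [hhv, Matrix.mulVec_add, Matrix.mulVec_smul, smul_comm r, ← smul_add]
  congr 1
  rw [Finset.smul_sum, ← Finset.sum_add_distrib]
  refine Finset.sum_congr rfl fun b _ => ?_
  rw [Finset.smul_sum, ← Finset.sum_add_distrib]
  refine Finset.sum_congr rfl fun b' _ => ?_
  rw [Pi.add_apply, Pi.smul_apply, smul_eq_mul, smul_smul, ← add_smul]
  congr 1
  ring

/-! ## §2 #21-Sym's `c2` row with the fine second jet on the diagonal of the bilinear companion (`d + 1 = 4`, the record's dimension) -/

end Directional

section Polar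

variable (Lc : ℕ) [NeZero Lc] (M' : Fin (3 + 1) → ℕ) [∀ μ, NeZero (M' μ)] (lev : ℕ → ℕ) (n : ℕ) (c : ℝ)

/-- [folklore] **`torus_c2_towerSym_polar` — #21-Sym's ∕ #41c-Sym's `c2` AT `Q₁₂f v v := c² • compIns₂₂Sym … h h`** (`h := hv v`): `TorusCompositeCovarianceTwoRowsSym.torus_c2_towerSym`
after ONE `compIns₂₂Sym_self`; `hW₁ hW₂` VERBATIM at the constant centred root list, `D̄₂` = the PURE SQUARE. -/
theorem torus_c2_towerSym_polar (hc : ctrOff (3 + 1) Lc ∈ box (3 + 1) Lc) (h : ↥(pbox (towerTorus Lc M' (n + 1))) × Fin (3 + 1) → ℝ)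
    {W₁ W₂ : Matrix (↥(pbox (towerTorus Lc M' (n + 1))) × Fin (3 + 1)) (NParam Lc M' (fun _ : ℕ => ctrOff (3 + 1) Lc) (n + 1)) ℝ}
    (hW₁ : W₁ = Matrix.of fun (b : (↥(pbox (towerTorus Lc M' (n + 1))) × Fin (3 + 1))) (e : NParam Lc M' (fun _ : ℕ => ctrOff (3 + 1) Lc) (n + 1)) =>
      -(c * h b * evalN Lc M' (fun _ : ℕ => ctrOff (3 + 1) Lc) (n + 1) (fun b' : (↥(pbox (towerTorus Lc M' (n + 1))) × Fin (3 + 1)) => (b'.1 : Site (3 + 1)) + unitVec b'.2) b e))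
    (hW₂ : W₂ = Matrix.of fun (b : (↥(pbox (towerTorus Lc M' (n + 1))) × Fin (3 + 1))) (e : NParam Lc M' (fun _ : ℕ => ctrOff (3 + 1) Lc) (n + 1)) =>
      (c * h b) ^ 2 * evalN Lc M' (fun _ : ℕ => ctrOff (3 + 1) Lc) (n + 1) (fun b' : (↥(pbox (towerTorus Lc M' (n + 1))) × Fin (3 + 1)) => (b'.1 : Site (3 + 1)) + unitVec b'.2) b e) :
    c ^ 2 • compIns₂₂Sym Lc M' lev (fun _ : ℕ => ctrOff (3 + 1) Lc) (n + 1) h h * towerGen Lc M' (fun _ : ℕ => ctrOff (3 + 1) Lc) (n + 1)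
        + (2 : ℝ) • (c • compIns₁Sym Lc M' lev (fun _ : ℕ => ctrOff (3 + 1) Lc) (n + 1) h * W₁) + compRowsSym Lc M' lev (fun _ : ℕ => ctrOff (3 + 1) Lc) (n + 1) * W₂
      = Matrix.fromCols
          (Matrix.of fun (a : ↥(pbox M') × Fin (3 + 1)) (t : Res (toSite (ctrOff (3 + 1) Lc)) Lc M') =>
            (c ^ 2 * (∏ i ∈ range (n + 1), (stepScale 3 Lc (lev (i + 1)) * ((box (3 + 1) Lc).card : ℝ)))⁻¹)
              * ((compRowsSym Lc M' lev (fun _ : ℕ => ctrOff (3 + 1) Lc) (n + 1) *ᵥ h) a) ^ 2 * tdelta M' ((a.1 : Site (3 + 1)) + unitVec a.2) t.1)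
          (0 : Matrix (↥(pbox M') × Fin (3 + 1)) (NParam Lc (fine Lc M') (fun _ : ℕ => ctrOff (3 + 1) Lc) n) ℝ) := by
  rw [compIns₂₂Sym_self]
  exact torus_c2_towerSym Lc M' lev hc n c h hW₁ hW₂

end Polar

end Summit.QuantumFields.BalabanUV.Beta.FP.TorusCompositeRowsDirectionalSym

end
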